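import Mathlib
import Summits.ValiantsHypothesis.ValiantsHypothesis.Theses.BinomialElusive

/-!
# Disproof of `PeelingLemma` (stmt-ValiantsHypothesis-7391) — findings of val-width-7391-ref-1 (cdisprove)

Status line: `PeelingLemma` is FALSE modulo the construction item "relation-free all-X designs exist"
(kernel reductions landed: p553410 exponent level [p1], p555890 vector level incl. generic weights
[ref-1, review-queued]); the construction item has a refereed paper proof
(`Cruxes/PeelingLemma/ALLX-PROOF-SKETCH.md` + `REFEREE-ref1.md`), no Lean proof (≈ 4–5 klines).
VP ≠ VNP is not moved either way.

## Findings (potential form of all-X designs; details in the refuter's NOTES and REFEREE-ref1.md)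
* F0 REFORMULATION. An all-X design is a bipartite-or-not multigraph `G` (registers = vertices `V` and
  letters `Λ`, outputs = edges, `|E| = |V| + |Λ| + 1`) with integer vectors `ψ, ψ' : V → ℤ^Λ` whose
  edge sums are pair vectors; a relation `(u,u')` is exactly a pair of CHARGES `c¹, c²` on `V` with
  `Σ c¹_x ψ_x = 0 = Σ c²_x ψ'_x` (p1's Lemma B).  Every even closed walk of `G` of length `r` is a
  relation of length `r` (odd cycles: `2r`), so `girth(G) > ⌊log₂ m⌋²` is necessary: `G` is a subdivided
  branch graph `H` with threads of length `L ≳ log m`, and letters are necessarily shared by many threads.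
* F1 END-LABEL OBSTRUCTION. If all branch potentials coincide (every thread a closed letter walk), the
  `2|E(H)|` end labels form a graph with ≥ 4× more edges than vertices ⇒ an even closed walk of length
  `O(log m)` ⇒ a relation of length `O(log m)`.  (Experiment j287144: ≈ 700 end-label 4-cycles per
  alphabet at m = 1920, R = 4.)  Cure: generic branch potentials — private branch letters (ref-1) or
  wide random FIFO vectors (p1 v5).
* F2 SLOT FORMULA (replaces p1's E2). Along a FIFO thread (letter `f_b` alive on `x_b..x_{b+2q}` with
  sign `(−1)^{k−b}`), the coefficient of `f_b` in `Σ_k c_k ψ_k` is `(−1)^b (Q_{b+2q} − Q_{b−1})`,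
  `Q_d = Σ_{k≤d} (−1)^k c_k`; so `#slots = #{d : Q_d ≠ Q_{d−(2q+1)}}`.  p1's `2N(c)` is the special case
  of windows of width `≤ 2q+1`.  Kernel version below: `slot_coeff`.
* F3 FEW-SLOTS / COST. On a thread, a cluster with `≤ 3` slots is a single residue class and costs
  `≥ 4q+2` (paper + ILP: 14, 18, 22 for q = 3, 4, 5).  AT BRANCH VERTICES p1's rule (distinct kept letters,
  FIFO-type retirement on both child arms) leaves 2-SLOT single-alphabet pieces of CONSTANT cost 6 (two
  death events of one letter at line distance 3; ILP jobs j287822/j288096, all 12 label-disjoint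
  configurations, q = 3,4,5); with a kept letter equal to the letter born at b the cost is 2.  Observed
  law: min cost of a nonzero `≤ 2`-slot cluster = `2·D`, `D` = least line distance between two events
  (birth / death / copy-birth / kept edge) of one letter.  REPAIR (ref-1): `q := ⌈ℓ/2⌉+1` and MIDDLE-OUT
  retirement / copy order on the third arm (kept = α_q) gives `D = q+1` (optimal), `2D > ℓ`; ILP j288211:
  `T = 1` infeasible, `T = 2` min cost `= 2D` in tree / closing / double-closing / mixed configurations.
* F4 GLOBAL COUNT. A cluster with `t` formal slots at one of `N` positions weighs `N·poly(ℓ)^t·s'^{−t/2}`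
  (`N = m` on threads, `N = n_H ≈ 2s'` at branch vertices, `s' ≈ m/(3L)`); `t ≥ 3` suffices for
  `E[#relations of cost ≤ ℓ] → 0`, `t = 2` pieces at branch vertices give `Θ(1)`–`Θ(100)` expected
  relations (so the sketch's Lemma F fails for the design as written; the repaired design restores it).
  Relation-free designs then exist for all large `m` (threshold astronomically large; irrelevant for
  `∀ m₀ ∃ m ≥ m₀`).  Details: `Cruxes/PeelingLemma/REFEREE-ref1.md` §2–4 and ADDENDUM A.
* F5 NECESSARY CONDITIONS met by any counterexample: pairwise distinct gaps `b_i − a_i` (kernel: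
  `peeling_conclusion_of_gap_eq` below — a repeated gap gives a relation of length 4); girth as in F0;
  alphabet `s' ≫ √m` (birthday of 4-slot clusters; p1's lemma (a)).
* DEAD: closed-thread designs (F1); fixed alphabets; series registers `t^A (1+t^c)^ε` with monomial Γ
  (equal gaps forced by a rank count); a finite certificate (¬PeelingLemma needs unboundedly many m);
  "tiny gadget + padding" (Bezout caps the shortest relation of an `n₀`-register gadget by `C·2^{n₀}`,
  and no mechanism with exponential reach was found).

* F6 WINDING CHAINS (Addendum B of the referee report; kernel form `Negative/WindingRelation.lean`, p565107).
  In one alphabet let 𝓛 be the label graph (letters = vertices, one edge per design edge joining the two letters of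
  its pair label).  An even cycle of 𝓛 has vanishing alternating label sum; if the same design edges form an even
  cycle of BOTH label graphs then `u = v = (−1)^j` is a relation (`o₁+o₂ = π ⊕ π'`).  Label chains wind around every
  cycle of the design graph and close after `w` windings (`w` = cycle length of the phase-return permutation of
  ℤ/(2q+1)).  COMPUTED (sign-valid designs, exponent-level certificates, item evidence WINDING-CERTIFICATES.txt):
  with the second alphabet built by the same rules, g0's FIFO design on K₄ / K₃,₃ / Petersen / Heawood / prism has
  relations of cost `4·girth(H)` (12–24) and g2's Θ₅(L′,q) gadgets relations of cost 8 (label 4-cycles at the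
  validation sizes) resp. ≈ `4L′/(2q+1)` ≈ 16–20 (long arms) — BOUNDED, so neither blueprint as written refutes
  `PeelingLemma`.  Repairs: pointwise alphabet-asymmetric crossing maps at every branch vertex / gadget end (R1) or
  return permutations with only long cycles (R2); both need the local lemma on windows that wrap a cycle.
## HANDOFF
Landed under `Theorems/PeelingLemma/Negative/`: `PeelingLemmaFalseOfAllXDesigns.lean` (p1, p553410),
`PeelingLemmaFalseOfAllXDesignsExist.lean` (ref-1, p555890 ACCEPTED), `FifoSlotCalculus.lean` (ref-1,
p558815: `fifoVec`, design identity `ψ_k + ψ_{k+1} = e_{f(k−2q)} + e_{f(k+1)}`, `slot_coeff`, Lemma E1 for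
all widths).  This file: `slot_coeff` (F2) and `peeling_conclusion_of_gap_eq` (F5), sorry-free.
`WindingRelation.lean` (ref-1, p565107: Lemma W).  STATUS: both published constructions (g0 FIFO, g2 Θ₅) are
broken as written by F6; `AllXDesignsExist` itself is open.  Next for a successor: (0) decide R1 vs R2 and
re-validate by the label-graph cycle finder (`wind2.py` / `theta.py` in the ref-1 folder) BEFORE any Lean; (1) prove the law "≤ 2 slots ⇒ cost ≥ 2D" for general q (extremisers are
single-letter event pairs; a 2-slot single-alphabet cluster is an alternating path in the label graph,
cost = 2 × min-cost matching of its ± labels) and E1 on spiders for general q; (2) the counting lemma F4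
as a pure `Finset` first-moment bound with the weights above; (3) prism graphs `C_n □ K_2` as the
explicit cubic family (girth 4 suffices); (4) assemble `AllXDesignsExist` and compose with p555890.
ILP scripts: refuter folder `work/job2/main.py`, `main3.py` (schedules `sched_C`, `sched_K`).
-/

set_option linter.dupNamespace false

namespace Summit.ValiantsHypothesis.ValiantsHypothesis.Cruxes.PeelingLemma.Disproof

open scoped BigOperators
open Finset

/-! ## F5: a repeated gap yields a relation of length 4 -/

/-- If two outputs `i ≠ j` have the same gap `b i - a i = b j - a j`, then
`(u, v) = (-e_i + e_j, e_i - e_j)` is a nonzero relation of length `4`: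
`-a_i + b_i + a_j - b_j = 0`.  Hence every counterexample to `PeelingLemma` (at an `m` with
`4 ≤ ⌊log₂ m⌋²`) has pairwise distinct gaps. -/
theorem peeling_conclusion_of_gap_eq {m : ℕ} (a b : Fin m → ℕ) {i j : Fin m} (hij : i ≠ j)
    (hgap : (b i : ℤ) - a i = (b j : ℤ) - a j) (hm : 4 ≤ Nat.log 2 m ^ 2) :
    ∃ u v : Fin m → ℤ, (u, v) ≠ 0 ∧ ∑ k, (|u k| + |v k|) ≤ ((Nat.log 2 m ^ 2 : ℕ) : ℤ) ∧
      ∑ k, (u k * (a k : ℤ) + v k * (b k : ℤ)) = 0 := by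
  classical
  refine ⟨fun k => if k = i then -1 else if k = j then 1 else 0,
    fun k => if k = i then 1 else if k = j then -1 else 0, ?_, ?_, ?_⟩
  · intro h
    have h1 := congrArg (fun p : (Fin m → ℤ) × (Fin m → ℤ) => p.2 i) h
    simp at h1
  · -- the length is exactly 4
    have hsplit : ∀ k : Fin m,
        (|(if k = i then (-1 : ℤ) else if k = j then 1 else 0)| +
          |(if k = i then (1 : ℤ) else if k = j then -1 else 0)|) =
          (if k = i then 2 else 0) + (if k = j then 2 else 0) := by
      intro k
      by_cases hki : k = i
      · subst hki; simp [hij]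
      · by_cases hkj : k = j
        · subst hkj; simp [hki]
        · simp [hki, hkj]
    rw [Finset.sum_congr rfl (fun k _ => hsplit k), Finset.sum_add_distrib,
      Finset.sum_ite_eq' Finset.univ i, Finset.sum_ite_eq' Finset.univ j]
    simp only [Finset.mem_univ, if_true]
    have h4 : (4 : ℤ) ≤ ((Nat.log 2 m ^ 2 : ℕ) : ℤ) := by exact_mod_cast hm
    linarith
  · have hsplit : ∀ k : Fin m,
        ((if k = i then (-1 : ℤ) else if k = j then 1 else 0) * (a k : ℤ) +
          (if k = i then (1 : ℤ) else if k = j then -1 else 0) * (b k : ℤ)) =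
          (if k = i then ((b i : ℤ) - a i) else 0) + (if k = j then ((a j : ℤ) - b j) else 0) := by
      intro k
      by_cases hki : k = i
      · subst hki; simp [hij]; ring
      · by_cases hkj : k = j
        · subst hkj; simp [hki]; ring
        · simp [hki, hkj]
    rw [Finset.sum_congr rfl (fun k _ => hsplit k), Finset.sum_add_distrib,
      Finset.sum_ite_eq' Finset.univ i, Finset.sum_ite_eq' Finset.univ j]
    simp only [Finset.mem_univ, if_true]
    omega

/-! ## F2: the slot formula for FIFO threads

Abstract setting: vertices and birth times are integers; the letter born at time `b` is `f b`; the
vertex vector at `k` is `ψ k = Σ_{b ∈ [k-2q, k]} (-1)^(k-b) e_{f b}`.  For a charge `c` supported in a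
finite set `S` of vertices, the coefficient of a letter `λ` in `Σ_{k∈S} c k • ψ k` is
`Σ_{k ∈ S} Σ_{b ∈ [k-2q,k], f b = λ} (-1)^(k-b) c k`; when `f` is injective near `S` and `λ = f b₀`
this is the signed interval sum `Σ_{k ∈ S ∩ [b₀, b₀+2q]} (-1)^(k-b₀) c k` — the quantity
`± (Q_{b₀+2q} − Q_{b₀−1})` of F2. -/

/-- The FIFO vertex vector at vertex `k` (lifetime `2q+1`, alternating signs), as a finitely
supported function on letters. -/
noncomputable def fifoVec {Λ : Type*} [DecidableEq Λ] (f : ℤ → Λ) (q : ℕ) (k : ℤ) : Λ → ℤ :=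
  fun l => ∑ b ∈ Finset.Icc (k - 2 * q) k, if f b = l then (-1) ^ (k - b).toNat else 0

/-- **Slot formula.**  The coefficient of the letter `f b₀` in `Σ_{k ∈ S} c k • ψ k` is the signed
charge sum over the lifetime window `[b₀, b₀ + 2q]` of that letter, provided `f` does not repeat the
letter `f b₀` at any other birth time seen from `S` (local freshness). -/
theorem slot_coeff {Λ : Type*} [DecidableEq Λ] (f : ℤ → Λ) (q : ℕ) (S : Finset ℤ) (c : ℤ → ℤ)
    (b₀ : ℤ) (hfresh : ∀ k ∈ S, ∀ b ∈ Finset.Icc (k - 2 * q) k, f b = f b₀ → b = b₀) :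
    (∑ k ∈ S, c k * fifoVec f q k (f b₀)) =
      ∑ k ∈ S.filter (fun k => b₀ ≤ k ∧ k ≤ b₀ + 2 * q), (-1) ^ (k - b₀).toNat * c k := by
  rw [Finset.sum_filter]
  refine Finset.sum_congr rfl (fun k hk => ?_)
  unfold fifoVec
  -- the inner sum over births collapses to the single birth `b₀` (if it lies in the window)
  have hinner : (∑ b ∈ Finset.Icc (k - 2 * q) k, if f b = f b₀ then (-1 : ℤ) ^ (k - b).toNat else 0)
      = if b₀ ∈ Finset.Icc (k - 2 * q) k then (-1) ^ (k - b₀).toNat else 0 := by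
    rw [← Finset.sum_filter]
    have hfilter : (Finset.Icc (k - 2 * q) k).filter (fun b => f b = f b₀)
        = (Finset.Icc (k - 2 * q) k).filter (fun b => b = b₀) := by
      ext b
      simp only [Finset.mem_filter, and_congr_right_iff]
      intro hb
      exact ⟨fun h => hfresh k hk b hb h, fun h => by rw [h]⟩
    rw [hfilter, Finset.filter_eq' (Finset.Icc (k - 2 * q) k) b₀]
    split_ifs with h <;> simp
  rw [hinner]
  have hiff : b₀ ∈ Finset.Icc (k - 2 * ↑q) k ↔ (b₀ ≤ k ∧ k ≤ b₀ + 2 * ↑q) := by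
    rw [Finset.mem_Icc]; constructor <;> intro h <;> constructor <;> linarith [h.1, h.2]
  by_cases h : b₀ ≤ k ∧ k ≤ b₀ + 2 * ↑q
  · rw [if_pos (hiff.mpr h), if_pos h, mul_comm]
  · rw [if_neg (fun h' => h (hiff.mp h')), if_neg h, mul_zero]

end Summit.ValiantsHypothesis.ValiantsHypothesis.Cruxes.PeelingLemma.Disproof
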